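import Literature.MathematicalPhysics.KineticTheory.TruncatedCollisionCoefficients
import Mathlib.Analysis.Calculus.ContDiff.Bounds
import Mathlib.Analysis.Calculus.IteratedDeriv.Lemmas
import HarnessLib

/-!
# Derivative estimates for the coefficients of the truncated collision operator

Topic: MathematicalPhysics / KineticTheory. Continuation of `TruncatedCollisionCoefficients`:
bounds on all (total, space-time) derivatives of the loss frequency, the gain term and the mass
of a smooth space-time function `f : ℝ × E × E → ℝ`, in the weighted form
`(1 + ‖(x,v)‖)^k ‖D^n (·)(t,x,v)‖ ≤ …` on a set of times, in terms of the same quantities for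
`f`. The estimates are *affine in the top order* `n` with coefficients made of lower orders —
the structure that lets the uniform bounds of the DiPerna–Lions approximating scheme be proved
by induction on the order. Key point: in the relative-velocity formulation the arguments
`v - z`, `v - ⟨z,ω⟩ω`, `v - z + ⟨z,ω⟩ω` are translates of `v`, so `D^n` commutes with them
exactly (`iteratedFDeriv_comp_sub`) and no weight is lost.

* `norm_iteratedFDeriv_comp_scalar_affine` — Faà di Bruno for `φ ∘ u`, `φ : ℝ → ℝ`, with the
  top order of `u` entering linearly with coefficient `sup |φ'|` (for `exp ∘ (-·)` and the
  normalisation `(1 + δρ)⁻¹`).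
* `norm_iteratedFDeriv_comp_proj_le`, `weighted_iteratedFDeriv_coeff_mul` — Leibniz for
  `α(t,x) L(t,x,v)`.
* `lossFrequency_weighted_iteratedFDeriv` — `(1+‖(x,v)‖)^k ‖D^n L f‖ ≤ (1+R)^k (∫A) B_{k,n}`.
* `gain_weighted_iteratedFDeriv` —
  `(1+‖(x,v)‖)^k ‖D^n G f‖ ≤ (1+R)^k (Σ_i C(n,i) B_{k,i} B_{0,n-i}) ∫∫ b`.
* `mass_iteratedFDeriv_le` — `‖D^n m‖ ≤ B ∫(1+‖u‖)^{-k₀} du` from the weight-`k₀` bound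
  (`k₀ > dim E`), through the time-localised dominated differentiation formula;
  `decay_of_weighted_bound`.

Everything is proved; theorems only.

## References

* C. Cercignani, R. Illner, M. Pulvirenti, *The Mathematical Theory of Dilute Gases*, Springer
  (1994), §5.3, Lemma 5.3.6 (the truncated problems), pp. 145–146.
-/

open MeasureTheory Metric Real Set Filter Topology
open scoped InnerProductSpace ENNReal NNReal

noncomputable section

namespace Literature.MathematicalPhysics.KineticTheory

open Literature.Analysis.FluidPDE Literature.Analysis.FunctionSpaces

/-! ## Post-composition with a scalar function: the top order enters linearly -/

section ScalarComp

variable {X : Type*} [NormedAddCommGroup X] [NormedSpace ℝ X]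

/-- **Affine Faà di Bruno bound for `φ ∘ u` with `φ : ℝ → ℝ`.** If `u` takes values in `[a, b]`,
`|φ'| ≤ Φ₁` and `|φ^{(j)}| ≤ Φm` (`1 ≤ j ≤ n+1`) on `[a, b]`, and `‖D^i u(x)‖ ≤ D^i` for
`1 ≤ i ≤ n`, then
`‖D^{n+1}(φ ∘ u)(x)‖ ≤ Φ₁ ‖D^{n+1} u(x)‖ + Σ_{i=1}^{n} C(n,i) (i! Φm D^i) ‖D^{n+1-i} u(x)‖`:
the top-order derivative of `u` enters linearly, with coefficient `Φ₁` (write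
`D^{n+1}(φ ∘ u) = D^n((φ' ∘ u) • Du)`, Leibniz, and the crude bound
`norm_iteratedFDeriv_comp_le` only for the lower-order factors). [folklore] -/
theorem norm_iteratedFDeriv_comp_scalar_affine {φ : ℝ → ℝ} (hφ : ContDiff ℝ ((⊤ : ℕ∞) : WithTop ℕ∞) φ)
    {u : X → ℝ} (hu : ContDiff ℝ ((⊤ : ℕ∞) : WithTop ℕ∞) u) {a b : ℝ} (hrange : ∀ x, u x ∈ Icc a b)
    (n : ℕ) (x : X) {Φ₁ Φm D : ℝ}
    (hΦ1 : ∀ y ∈ Icc a b, ‖iteratedFDeriv ℝ 1 φ y‖ ≤ Φ₁)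
    (hΦm : ∀ j, 1 ≤ j → j ≤ n + 1 → ∀ y ∈ Icc a b, ‖iteratedFDeriv ℝ j φ y‖ ≤ Φm)
    (hD : ∀ i, 1 ≤ i → i ≤ n → ‖iteratedFDeriv ℝ i u x‖ ≤ D ^ i) :
    ‖iteratedFDeriv ℝ (n + 1) (φ ∘ u) x‖ ≤
      Φ₁ * ‖iteratedFDeriv ℝ (n + 1) u x‖ +
        ∑ i ∈ Finset.Icc 1 n, (n.choose i : ℝ) * ((Nat.factorial i : ℝ) * Φm * D ^ i) * ‖iteratedFDeriv ℝ (n + 1 - i) u x‖ := by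
  have h1 : ((⊤ : ℕ∞) : WithTop ℕ∞) ≠ 0 := by exact_mod_cast WithTop.coe_ne_zero.2 (by decide)
  have hφd : Differentiable ℝ φ := hφ.differentiable h1
  have hud : Differentiable ℝ u := hu.differentiable h1
  have hφ' : ContDiff ℝ ((⊤ : ℕ∞) : WithTop ℕ∞) (deriv φ) := (contDiff_infty_iff_deriv.1 hφ).2
  -- `D(φ ∘ u) = (φ' ∘ u) • Du`
  set av : X → ℝ := fun y => deriv φ (u y) with hav
  set w : X → (X →L[ℝ] ℝ) := fderiv ℝ u with hw
  have hfd : fderiv ℝ (φ ∘ u) = fun y => av y • w y := by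
    funext y
    have h := ((hφd (u y)).hasDerivAt.hasFDerivAt.comp y (hud y).hasFDerivAt).fderiv
    rw [h]
    ext v
    simp [hav, hw, mul_comm]
  have havs : ContDiff ℝ ((⊤ : ℕ∞) : WithTop ℕ∞) av := hφ'.comp hu
  have hws : ContDiff ℝ ((⊤ : ℕ∞) : WithTop ℕ∞) w := hu.fderiv_right (m := ((⊤ : ℕ∞) : WithTop ℕ∞)) le_rfl
  rw [← norm_iteratedFDeriv_fderiv, hfd]
  have hleib := norm_iteratedFDeriv_smul_le (n := n) havs hws x (by exact_mod_cast le_top)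
  refine hleib.trans ?_
  -- split off `i = 0`
  rw [Finset.range_eq_Ico, Finset.sum_eq_sum_Ico_succ_bot (Nat.succ_pos n)]
  refine add_le_add ?_ ?_
  · -- the top-order term: `‖av x‖ ‖D^n w x‖ = |φ'(u x)| ‖D^{n+1} u x‖`
    simp only [Nat.choose_zero_right, Nat.cast_one, one_mul, norm_iteratedFDeriv_zero, Nat.sub_zero]
    rw [hw, norm_iteratedFDeriv_fderiv]
    refine mul_le_mul_of_nonneg_right ?_ (norm_nonneg _)
    have h := hΦ1 (u x) (hrange x)
    rw [← norm_iteratedFDeriv_fderiv, norm_iteratedFDeriv_zero] at h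
    simp only [hav, Real.norm_eq_abs]
    rw [← norm_deriv_eq_norm_fderiv] at h
    exact h
  · -- the lower-order terms
    have hIco : Finset.Ico 1 (n + 1) = Finset.Icc 1 n := by
      ext i; simp
    rw [hIco]
    refine Finset.sum_le_sum fun i hi => ?_
    rw [Finset.mem_Icc] at hi
    have hwi : ‖iteratedFDeriv ℝ (n - i) w x‖ = ‖iteratedFDeriv ℝ (n + 1 - i) u x‖ := by
      rw [hw, norm_iteratedFDeriv_fderiv, show n - i + 1 = n + 1 - i by omega]
    rw [hwi]
    refine mul_le_mul_of_nonneg_right (mul_le_mul_of_nonneg_left ?_ (by positivity)) (norm_nonneg _)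
    -- crude Faà di Bruno for `φ' ∘ u` at order `i ≤ n`
    have hcomp := norm_iteratedFDeriv_comp_le (g := deriv φ) (f := u) (n := i) (N := ((⊤ : ℕ∞) : WithTop ℕ∞))
      hφ' hu (by exact_mod_cast le_top) x (C := Φm) (D := D) ?_ ?_
    · exact hcomp
    · intro j hj
      -- `‖D^j (φ') (u x)‖ = ‖D^{j+1} φ (u x)‖`
      have e : ‖iteratedFDeriv ℝ j (deriv φ) (u x)‖ = ‖iteratedFDeriv ℝ (j + 1) φ (u x)‖ := by
        rw [norm_iteratedFDeriv_eq_norm_iteratedDeriv, norm_iteratedFDeriv_eq_norm_iteratedDeriv, iteratedDeriv_succ']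
      rw [e]
      exact hΦm (j + 1) (by omega) (by omega) (u x) (hrange x)
    · exact fun k hk1 hki => hD k hk1 (le_trans hki hi.2)

end ScalarComp

variable {E : Type*} [NormedAddCommGroup E] [InnerProductSpace ℝ E] [FiniteDimensional ℝ E]
  [MeasurableSpace E] [BorelSpace E]

/-! ## Products with coefficients depending on `(t, x)` only -/

section Product

omit [InnerProductSpace ℝ E] [FiniteDimensional ℝ E] [MeasurableSpace E] [BorelSpace E] in
/-- Derivatives of `p ↦ α(t, x)` on `ℝ × E × E` are those of `α` composed with the projection
(norm `≤ 1`): `‖D^i (α ∘ π)(p)‖ ≤ ‖D^i α (π p)‖`. [folklore] -/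
theorem norm_iteratedFDeriv_comp_proj_le [NormedSpace ℝ E] {α : ℝ × E → ℝ}
    (hα : ContDiff ℝ ((⊤ : ℕ∞) : WithTop ℕ∞) α) (i : ℕ) (p : ℝ × E × E) :
    ‖iteratedFDeriv ℝ i (fun q : ℝ × E × E => α (q.1, q.2.1)) p‖ ≤ ‖iteratedFDeriv ℝ i α (p.1, p.2.1)‖ := by
  set prj : ℝ × E × E →L[ℝ] ℝ × E := (ContinuousLinearMap.fst ℝ ℝ (E × E)).prod
    ((ContinuousLinearMap.fst ℝ E E).comp (ContinuousLinearMap.snd ℝ ℝ (E × E))) with hprj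
  have hcomp : (fun q : ℝ × E × E => α (q.1, q.2.1)) = α ∘ prj := by funext q; rfl
  have hle : ‖prj‖ ≤ 1 := by
    refine ContinuousLinearMap.opNorm_le_bound _ zero_le_one fun q => ?_
    rw [one_mul, hprj]
    simp only [ContinuousLinearMap.prod_apply, ContinuousLinearMap.coe_fst', ContinuousLinearMap.coe_comp,
      Function.comp_apply, ContinuousLinearMap.coe_snd', Prod.norm_def]
    exact max_le (le_max_left _ _) ((norm_fst_le q.2).trans (le_max_right _ _))
  rw [hcomp, prj.iteratedFDeriv_comp_right hα p (by exact_mod_cast le_top)]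
  refine (ContinuousMultilinearMap.norm_compContinuousLinearMap_le _ _).trans ?_
  rw [Finset.prod_const, Finset.card_univ, Fintype.card_fin]
  calc ‖iteratedFDeriv ℝ i α (prj p)‖ * ‖prj‖ ^ i ≤ ‖iteratedFDeriv ℝ i α (prj p)‖ * 1 := by
        refine mul_le_mul_of_nonneg_left (pow_le_one₀ (norm_nonneg _) hle) (norm_nonneg _)
    _ = _ := by rw [mul_one]; rfl

omit [InnerProductSpace ℝ E] [FiniteDimensional ℝ E] [MeasurableSpace E] [BorelSpace E] in
/-- **Weighted Leibniz bound for `α(t,x) · L(t,x,v)`**: with `‖D^i α‖ ≤ a_i` on the time set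
and `(1+‖(x,v)‖)^k ‖D^j L‖ ≤ ℓ_j` there,
`(1+‖(x,v)‖)^k ‖D^n(αL)(p)‖ ≤ Σ_i C(n,i) a_i ℓ_{n-i}`. [folklore] -/
theorem weighted_iteratedFDeriv_coeff_mul [NormedSpace ℝ E] {α : ℝ × E → ℝ} {L : ℝ × E × E → ℝ}
    (hα : ContDiff ℝ ((⊤ : ℕ∞) : WithTop ℕ∞) α) (hL : ContDiff ℝ ((⊤ : ℕ∞) : WithTop ℕ∞) L)
    {S : Set ℝ} (k n : ℕ) {a ℓ : ℕ → ℝ}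
    (ha : ∀ i, i ≤ n → ∀ q : ℝ × E, q.1 ∈ S → ‖iteratedFDeriv ℝ i α q‖ ≤ a i)
    (hℓ : ∀ j, j ≤ n → ∀ p : ℝ × E × E, p.1 ∈ S → (1 + ‖p.2‖) ^ k * ‖iteratedFDeriv ℝ j L p‖ ≤ ℓ j)
    (p : ℝ × E × E) (hp : p.1 ∈ S) :
    (1 + ‖p.2‖) ^ k * ‖iteratedFDeriv ℝ n (fun q : ℝ × E × E => α (q.1, q.2.1) * L q) p‖ ≤
      ∑ i ∈ Finset.range (n + 1), (n.choose i : ℝ) * a i * ℓ (n - i) := by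
  have hαπ : ContDiff ℝ ((⊤ : ℕ∞) : WithTop ℕ∞) fun q : ℝ × E × E => α (q.1, q.2.1) :=
    hα.comp (contDiff_fst.prodMk (contDiff_fst.comp contDiff_snd))
  have hleib := norm_iteratedFDeriv_mul_le (n := n) hαπ hL p (by exact_mod_cast le_top)
  calc (1 + ‖p.2‖) ^ k * ‖iteratedFDeriv ℝ n (fun q : ℝ × E × E => α (q.1, q.2.1) * L q) p‖
      ≤ (1 + ‖p.2‖) ^ k * ∑ i ∈ Finset.range (n + 1), (n.choose i : ℝ) *
          ‖iteratedFDeriv ℝ i (fun q : ℝ × E × E => α (q.1, q.2.1)) p‖ * ‖iteratedFDeriv ℝ (n - i) L p‖ :=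
        mul_le_mul_of_nonneg_left hleib (by positivity)
    _ = ∑ i ∈ Finset.range (n + 1), (n.choose i : ℝ) *
          ‖iteratedFDeriv ℝ i (fun q : ℝ × E × E => α (q.1, q.2.1)) p‖ * ((1 + ‖p.2‖) ^ k * ‖iteratedFDeriv ℝ (n - i) L p‖) := by
        rw [Finset.mul_sum]; refine Finset.sum_congr rfl fun i _ => by ring
    _ ≤ ∑ i ∈ Finset.range (n + 1), (n.choose i : ℝ) * a i * ℓ (n - i) := by
        refine Finset.sum_le_sum fun i hi => ?_
        rw [Finset.mem_range] at hi
        have h1 : ‖iteratedFDeriv ℝ i (fun q : ℝ × E × E => α (q.1, q.2.1)) p‖ ≤ a i :=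
          (norm_iteratedFDeriv_comp_proj_le hα i p).trans (ha i (by omega) _ hp)
        have h2 : (1 + ‖p.2‖) ^ k * ‖iteratedFDeriv ℝ (n - i) L p‖ ≤ ℓ (n - i) := hℓ (n - i) (by omega) p hp
        have ha0 : 0 ≤ a i := (norm_nonneg _).trans h1
        exact mul_le_mul (mul_le_mul_of_nonneg_left h1 (by positivity)) h2 (by positivity) (by positivity)

end Product

/-! ## The loss frequency -/

section Loss

variable {A : E → ℝ} {f Lf : ℝ × E × E → ℝ}

/-- **Weighted derivative bounds for the loss frequency**: translations in `v` commute with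
derivatives, so `D^n (L f) = ∫ A(z) (D^n f)(t,x,v-z) dz` and
`(1+‖(x,v)‖)^k ‖D^n (L f)(p)‖ ≤ (1+R)^k (∫A) B_{k,n}`. [folklore] -/
theorem lossFrequency_weighted_iteratedFDeriv (hA : ContDiff ℝ ((⊤ : ℕ∞) : WithTop ℕ∞) A) (hA0 : ∀ z, 0 ≤ A z)
    {R : ℝ} (hR : 0 ≤ R) (hAR : ∀ z : E, R ≤ ‖z‖ → A z = 0) (hf : ContDiff ℝ ((⊤ : ℕ∞) : WithTop ℕ∞) f)
    (hL : ∀ t x v, Lf (t, x, v) = ∫ z, A z * f (t, x, v - z)) {S : Set ℝ} (k n : ℕ) {B : ℝ}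
    (hB : ∀ p : ℝ × E × E, p.1 ∈ S → (1 + ‖p.2‖) ^ k * ‖iteratedFDeriv ℝ n f p‖ ≤ B)
    (p : ℝ × E × E) (hp : p.1 ∈ S) :
    (1 + ‖p.2‖) ^ k * ‖iteratedFDeriv ℝ n Lf p‖ ≤ (1 + R) ^ k * (∫ z, A z) * B := by
  haveI : IsFiniteMeasure ((volume : Measure E).restrict (closedBall (0 : E) R)) :=
    ⟨by rw [Measure.restrict_apply_univ]; exact measure_closedBall_lt_top⟩
  have hB0 : 0 ≤ B := le_trans (by positivity) (hB p hp)
  -- `L f` as a parametric integral over the ball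
  set G : E × (ℝ × E × E) → ℝ := fun q => A q.1 * f (q.2.1, q.2.2.1, q.2.2.2 - q.1) with hG
  have hGs : ContDiff ℝ ((⊤ : ℕ∞) : WithTop ℕ∞) G :=
    (hA.comp contDiff_fst).mul (hf.comp ((contDiff_fst.comp contDiff_snd).prodMk
      ((contDiff_fst.comp (contDiff_snd.comp contDiff_snd)).prodMk
        ((contDiff_snd.comp (contDiff_snd.comp contDiff_snd)).sub contDiff_fst))))
  have hLeq : Lf = fun q : ℝ × E × E => ∫ z, G (id z, q) ∂((volume : Measure E).restrict (closedBall (0 : E) R)) := by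
    funext q
    obtain ⟨t, x, v⟩ := q
    rw [hL, integral_eq_setIntegral_closedBall hAR]
    rfl
  have hformula := iteratedFDeriv_parametric_integral (μ := (volume : Measure E).restrict (closedBall (0 : E) R))
    (ι := (id : E → E)) measurable_id (isCompact_closedBall (0 : E) R) (ae_restrict_mem measurableSet_closedBall) hGs n p
  rw [hLeq, hformula]
  -- the sections: translation in `v`
  have hsec : ∀ z : E, iteratedFDeriv ℝ n (fun r : ℝ × E × E => G (id z, r)) p =
      A z • iteratedFDeriv ℝ n f (p - ((0 : ℝ), (0 : E), z)) := by
    intro z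
    have h1 : (fun r : ℝ × E × E => G (id z, r)) = A z • fun r : ℝ × E × E => f (r - ((0 : ℝ), (0 : E), z)) := by
      funext r
      obtain ⟨t, x, v⟩ := r
      simp only [hG, id, Pi.smul_apply, smul_eq_mul, Prod.mk_sub_mk, sub_zero]
    rw [h1, iteratedFDeriv_const_smul_apply, iteratedFDeriv_comp_sub]
    exact ((hf.comp (contDiff_id.sub contDiff_const)).of_le (by exact_mod_cast le_top)).contDiffAt
  simp_rw [hsec]
  -- pointwise bound on the ball
  have hpt : ∀ z ∈ closedBall (0 : E) R, (1 + ‖p.2‖) ^ k * (A z * ‖iteratedFDeriv ℝ n f (p - ((0 : ℝ), (0 : E), z))‖) ≤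
      A z * ((1 + R) ^ k * B) := by
    intro z hz
    rw [mem_closedBall, dist_zero_right] at hz
    have hw := weight_le_of_sub p.2.1 p.2.2 z hR hz k
    have htime : (p - ((0 : ℝ), (0 : E), z)).1 ∈ S := by simpa using hp
    have hsp : (p - ((0 : ℝ), (0 : E), z)).2 = (p.2.1, p.2.2 - z) := by
      obtain ⟨t, x, v⟩ := p; simp
    have hBz := hB (p - ((0 : ℝ), (0 : E), z)) htime
    rw [hsp] at hBz
    calc (1 + ‖p.2‖) ^ k * (A z * ‖iteratedFDeriv ℝ n f (p - ((0 : ℝ), (0 : E), z))‖)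
        = A z * ((1 + ‖(p.2.1, p.2.2)‖) ^ k * ‖iteratedFDeriv ℝ n f (p - ((0 : ℝ), (0 : E), z))‖) := by ring_nf
      _ ≤ A z * ((1 + R) ^ k * (1 + ‖(p.2.1, p.2.2 - z)‖) ^ k * ‖iteratedFDeriv ℝ n f (p - ((0 : ℝ), (0 : E), z))‖) :=
          mul_le_mul_of_nonneg_left (mul_le_mul_of_nonneg_right hw (norm_nonneg _)) (hA0 z)
      _ ≤ A z * ((1 + R) ^ k * B) := by
          rw [mul_assoc ((1 + R) ^ k)]
          exact mul_le_mul_of_nonneg_left (mul_le_mul_of_nonneg_left hBz (by positivity)) (hA0 z)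
  have hcont : Continuous fun z : E => A z * ‖iteratedFDeriv ℝ n f (p - ((0 : ℝ), (0 : E), z))‖ :=
    hA.continuous.mul ((hf.continuous_iteratedFDeriv (by exact_mod_cast le_top)).comp
      (continuous_const.sub (continuous_const.prodMk (continuous_const.prodMk continuous_id)))).norm
  calc (1 + ‖p.2‖) ^ k * ‖∫ z, A z • iteratedFDeriv ℝ n f (p - ((0 : ℝ), (0 : E), z)) ∂((volume : Measure E).restrict (closedBall (0 : E) R))‖
      ≤ (1 + ‖p.2‖) ^ k * ∫ z, ‖A z • iteratedFDeriv ℝ n f (p - ((0 : ℝ), (0 : E), z))‖ ∂((volume : Measure E).restrict (closedBall (0 : E) R)) :=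
        mul_le_mul_of_nonneg_left (norm_integral_le_integral_norm _) (by positivity)
    _ = ∫ z in closedBall (0 : E) R, (1 + ‖p.2‖) ^ k * (A z * ‖iteratedFDeriv ℝ n f (p - ((0 : ℝ), (0 : E), z))‖) := by
        rw [← integral_const_mul]
        refine integral_congr_ae (Eventually.of_forall fun z => ?_)
        show (1 + ‖p.2‖) ^ k * ‖A z • _‖ = _
        rw [norm_smul, Real.norm_eq_abs, abs_of_nonneg (hA0 z)]
    _ ≤ ∫ z in closedBall (0 : E) R, A z * ((1 + R) ^ k * B) :=
        setIntegral_mono_on ((continuous_const.mul hcont).continuousOn.integrableOn_compact (isCompact_closedBall _ _))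
          ((hA.continuous.mul continuous_const).continuousOn.integrableOn_compact (isCompact_closedBall _ _))
          measurableSet_closedBall hpt
    _ = (1 + R) ^ k * (∫ z, A z) * B := by
        rw [integral_mul_const]
        have hball : ∫ z in closedBall (0 : E) R, A z = ∫ z, A z := by
          have h := integral_eq_setIntegral_closedBall hAR (fun _ => (1 : ℝ))
          simp only [mul_one] at h
          exact h.symm
        rw [hball]; ring

end Loss

/-! ## The gain term -/

section Gain

variable {b : E × E → ℝ} {f Gf : ℝ × E × E → ℝ}

/-- Continuous functions on the unit sphere are `σ`-integrable. [folklore] -/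
theorem integrable_sphere_of_continuous {g : sphere (0 : E) 1 → ℝ} (hg : Continuous g) :
    Integrable g (sphereMeasure : Measure (sphere (0 : E) 1)) := by
  haveI := isFiniteMeasure_sphereMeasure (E := E)
  exact hg.integrable_of_hasCompactSupport (isClosed_tsupport g).isCompact

/-- **Weighted derivative bounds for the gain term.** Both arguments `v' = v - ⟨z,ω⟩ω` and
`w' = v - z + ⟨z,ω⟩ω` are translates of `v`, so
`D^n (G f)(p) = ∫∫ b(z,ω) D^n[f(· - c₁) f(· - c₂)](p) dσ dz` and Leibniz with the weight put on
the factor `f(v')` (`|v - v'| ≤ R`) gives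
`(1+‖(x,v)‖)^k ‖D^n (G f)(p)‖ ≤ (1+R)^k (Σ_i C(n,i) B_{k,i} B_{0,n-i}) ∫∫ b`. [folklore] -/
theorem gain_weighted_iteratedFDeriv (hbs : ContDiff ℝ ((⊤ : ℕ∞) : WithTop ℕ∞) b)
    (hb0 : ∀ (z : E) (ω : sphere (0 : E) 1), 0 ≤ b (z, ω))
    {R : ℝ} (hR : 0 ≤ R) (hbR : ∀ (z : E) (ω : sphere (0 : E) 1), R ≤ ‖z‖ → b (z, ω) = 0)
    (hf : ContDiff ℝ ((⊤ : ℕ∞) : WithTop ℕ∞) f)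
    (hG : ∀ t x v, Gf (t, x, v) = ∫ z, ∫ ω, b (z, ω) *
      (f (t, x, v - ⟪z, (ω : E)⟫_ℝ • (ω : E)) * f (t, x, v - z + ⟪z, (ω : E)⟫_ℝ • (ω : E)))
      ∂(sphereMeasure : Measure (sphere (0 : E) 1)))
    {S : Set ℝ} (k n : ℕ) {B : ℕ → ℕ → ℝ}
    (hB : ∀ (k' n' : ℕ) (p : ℝ × E × E), p.1 ∈ S → (1 + ‖p.2‖) ^ k' * ‖iteratedFDeriv ℝ n' f p‖ ≤ B k' n')
    (p : ℝ × E × E) (hp : p.1 ∈ S) :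
    (1 + ‖p.2‖) ^ k * ‖iteratedFDeriv ℝ n Gf p‖ ≤
      (1 + R) ^ k * (∑ i ∈ Finset.range (n + 1), (n.choose i : ℝ) * B k i * B 0 (n - i)) *
        ∫ z, ∫ ω, b (z, ω) ∂(sphereMeasure : Measure (sphere (0 : E) 1)) := by
  haveI := isFiniteMeasure_sphereMeasure (E := E)
  haveI : IsFiniteMeasure ((volume : Measure E).restrict (closedBall (0 : E) R)) :=
    ⟨by rw [Measure.restrict_apply_univ]; exact measure_closedBall_lt_top⟩
  have hB0 : ∀ k' n', 0 ≤ B k' n' := fun k' n' => le_trans (by positivity) (hB k' n' p hp)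
  set K : ℝ := (1 + R) ^ k * ∑ i ∈ Finset.range (n + 1), (n.choose i : ℝ) * B k i * B 0 (n - i) with hK
  have hK0 : 0 ≤ K := mul_nonneg (by positivity)
    (Finset.sum_nonneg fun i _ => by have := hB0 k i; have := hB0 0 (n - i); positivity)
  set w : ℝ := (1 + ‖p.2‖) ^ k with hw
  have hw0 : 0 < w := by positivity
  -- the two translation vectors
  set c₁ : E → sphere (0 : E) 1 → ℝ × E × E := fun z ω => ((0 : ℝ), (0 : E), ⟪z, (ω : E)⟫_ℝ • (ω : E)) with hc₁
  set c₂ : E → sphere (0 : E) 1 → ℝ × E × E := fun z ω => ((0 : ℝ), (0 : E), z - ⟪z, (ω : E)⟫_ℝ • (ω : E)) with hc₂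
  -- `G f` as an iterated parametric integral (as in `contDiff_gain`)
  set I : E × (ℝ × E × E) → ℝ := fun q => ∫ ω, b (q.1, ω) *
      (f (q.2.1, q.2.2.1, q.2.2.2 - ⟪q.1, (ω : E)⟫_ℝ • (ω : E)) *
        f (q.2.1, q.2.2.1, q.2.2.2 - q.1 + ⟪q.1, (ω : E)⟫_ℝ • (ω : E)))
      ∂(sphereMeasure : Measure (sphere (0 : E) 1)) with hI
  have hIs : ContDiff ℝ ((⊤ : ℕ∞) : WithTop ℕ∞) I := contDiff_gainAngular hbs hf
  have hGeq : Gf = fun q : ℝ × E × E => ∫ z, I (id z, q) ∂((volume : Measure E).restrict (closedBall (0 : E) R)) := by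
    funext q
    obtain ⟨t, x, v⟩ := q
    rw [hG]
    refine (setIntegral_eq_integral_of_forall_compl_eq_zero fun z hz => ?_).symm
    rw [mem_closedBall, dist_zero_right, not_le] at hz
    simp only [hbR z _ hz.le, zero_mul, integral_zero]
  have hformula := iteratedFDeriv_parametric_integral (μ := (volume : Measure E).restrict (closedBall (0 : E) R))
    (ι := (id : E → E)) measurable_id (isCompact_closedBall (0 : E) R) (ae_restrict_mem measurableSet_closedBall) hIs n p
  -- for fixed `z`, the inner integral as a parametric integral over the sphere
  have hinner : ∀ z : E, ‖iteratedFDeriv ℝ n (fun r : ℝ × E × E => I (id z, r)) p‖ ≤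
      (K / w) * ∫ ω, b (z, ω) ∂(sphereMeasure : Measure (sphere (0 : E) 1)) := by
    intro z
    by_cases hz : R < ‖z‖
    · -- outside the ball everything vanishes
      have h0 : (fun r : ℝ × E × E => I (id z, r)) = fun _ => 0 := by
        funext r; simp only [hI, id, hbR z _ hz.le, zero_mul, integral_zero]
      rw [h0, iteratedFDeriv_fun_zero]
      simp only [Pi.zero_apply, norm_zero]
      exact mul_nonneg (div_nonneg hK0 hw0.le) (integral_nonneg fun ω => hb0 z ω)
    rw [not_lt] at hz
    -- the section integrand
    set P : E × (ℝ × E × E) → ℝ := fun q => b (z, q.1) *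
      (f (q.2.1, q.2.2.1, q.2.2.2 - ⟪z, q.1⟫_ℝ • q.1) * f (q.2.1, q.2.2.1, q.2.2.2 - z + ⟪z, q.1⟫_ℝ • q.1)) with hP
    have hPs : ContDiff ℝ ((⊤ : ℕ∞) : WithTop ℕ∞) P := by
      have hy : ContDiff ℝ ((⊤ : ℕ∞) : WithTop ℕ∞) fun q : E × (ℝ × E × E) => ⟪z, q.1⟫_ℝ • q.1 :=
        (contDiff_const.inner ℝ contDiff_fst).smul contDiff_fst
      refine ((hbs.comp (contDiff_const.prodMk contDiff_fst)).mul ((hf.comp ?_).mul (hf.comp ?_)))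
      · exact (contDiff_fst.comp contDiff_snd).prodMk ((contDiff_fst.comp (contDiff_snd.comp contDiff_snd)).prodMk
          ((contDiff_snd.comp (contDiff_snd.comp contDiff_snd)).sub hy))
      · exact (contDiff_fst.comp contDiff_snd).prodMk ((contDiff_fst.comp (contDiff_snd.comp contDiff_snd)).prodMk
          (((contDiff_snd.comp (contDiff_snd.comp contDiff_snd)).sub contDiff_const).add hy))
    have hIz : (fun r : ℝ × E × E => I (id z, r)) =
        fun r => ∫ ω, P ((Subtype.val : sphere (0 : E) 1 → E) ω, r) ∂(sphereMeasure : Measure (sphere (0 : E) 1)) := by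
      funext r; rfl
    have hformula' := iteratedFDeriv_parametric_integral (μ := (sphereMeasure : Measure (sphere (0 : E) 1)))
      (ι := (Subtype.val : sphere (0 : E) 1 → E)) measurable_subtype_coe (isCompact_sphere (0 : E) 1)
      (Eventually.of_forall fun ω => ω.2) hPs n p
    rw [hIz, hformula']
    -- sections of `P`: `b • (f(· - c₁) f(· - c₂))`
    have hsec : ∀ ω : sphere (0 : E) 1, iteratedFDeriv ℝ n (fun r : ℝ × E × E => P ((ω : E), r)) p =
        b (z, ω) • iteratedFDeriv ℝ n (fun r : ℝ × E × E => f (r - c₁ z ω) * f (r - c₂ z ω)) p := by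
      intro ω
      have h1 : (fun r : ℝ × E × E => P ((ω : E), r)) = b (z, ω) • fun r : ℝ × E × E => f (r - c₁ z ω) * f (r - c₂ z ω) := by
        funext r
        obtain ⟨t, x, v⟩ := r
        simp only [hP, hc₁, hc₂, Pi.smul_apply, smul_eq_mul, Prod.mk_sub_mk, sub_zero]
        congr 3
        abel
      rw [h1, iteratedFDeriv_const_smul_apply]
      exact (((hf.comp (contDiff_id.sub contDiff_const)).mul (hf.comp (contDiff_id.sub contDiff_const))).of_le
        (by exact_mod_cast le_top)).contDiffAt
    simp_rw [hsec]
    -- Leibniz + translation + weights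
    have hptw : ∀ ω : sphere (0 : E) 1, ‖b (z, ω) • iteratedFDeriv ℝ n (fun r : ℝ × E × E => f (r - c₁ z ω) * f (r - c₂ z ω)) p‖ ≤
        (K / w) * b (z, ω) := by
      intro ω
      rw [norm_smul, Real.norm_eq_abs, abs_of_nonneg (hb0 z ω), mul_comm]
      refine mul_le_mul_of_nonneg_right ?_ (hb0 z ω)
      rw [le_div_iff₀ hw0, mul_comm]
      have hleib := norm_iteratedFDeriv_mul_le (n := n) (hf.comp (contDiff_id.sub contDiff_const))
        (hf.comp (contDiff_id.sub contDiff_const)) p (by exact_mod_cast le_top)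
        (f := fun r : ℝ × E × E => f (r - c₁ z ω)) (g := fun r : ℝ × E × E => f (r - c₂ z ω))
      refine (mul_le_mul_of_nonneg_left hleib hw0.le).trans ?_
      rw [hK, Finset.mul_sum, Finset.mul_sum]
      refine Finset.sum_le_sum fun i hi => ?_
      rw [iteratedFDeriv_comp_sub, iteratedFDeriv_comp_sub]
      -- weight transfer to the first factor
      have hcn : ‖⟪z, (ω : E)⟫_ℝ • (ω : E)‖ ≤ R := by
        rw [norm_smul, Real.norm_eq_abs, norm_eq_of_mem_sphere, mul_one]
        exact (abs_real_inner_le_norm _ _).trans (by rw [norm_eq_of_mem_sphere, mul_one]; exact hz)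
      have hwt := weight_le_of_sub p.2.1 p.2.2 (⟪z, (ω : E)⟫_ℝ • (ω : E)) hR hcn k
      have ht1 : (p - c₁ z ω).1 ∈ S := by simpa [hc₁] using hp
      have ht2 : (p - c₂ z ω).1 ∈ S := by simpa [hc₂] using hp
      have hs1 : (p - c₁ z ω).2 = (p.2.1, p.2.2 - ⟪z, (ω : E)⟫_ℝ • (ω : E)) := by
        obtain ⟨t, x, v⟩ := p; simp [hc₁]
      have hB1 := hB k i (p - c₁ z ω) ht1
      rw [hs1] at hB1
      have hB2 := hB 0 (n - i) (p - c₂ z ω) ht2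
      rw [pow_zero, one_mul] at hB2
      calc w * ((n.choose i : ℝ) * ‖iteratedFDeriv ℝ i f (p - c₁ z ω)‖ * ‖iteratedFDeriv ℝ (n - i) f (p - c₂ z ω)‖)
          = (n.choose i : ℝ) * ((1 + ‖(p.2.1, p.2.2)‖) ^ k * ‖iteratedFDeriv ℝ i f (p - c₁ z ω)‖) *
              ‖iteratedFDeriv ℝ (n - i) f (p - c₂ z ω)‖ := by rw [hw]; ring_nf
        _ ≤ (n.choose i : ℝ) * ((1 + R) ^ k * ((1 + ‖(p.2.1, p.2.2 - ⟪z, (ω : E)⟫_ℝ • (ω : E))‖) ^ k *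
              ‖iteratedFDeriv ℝ i f (p - c₁ z ω)‖)) * B 0 (n - i) := by
            refine mul_le_mul (mul_le_mul_of_nonneg_left ?_ (by positivity)) hB2 (norm_nonneg _) (by positivity)
            rw [← mul_assoc]; exact mul_le_mul_of_nonneg_right hwt (norm_nonneg _)
        _ ≤ (n.choose i : ℝ) * ((1 + R) ^ k * B k i) * B 0 (n - i) :=
            mul_le_mul_of_nonneg_right (mul_le_mul_of_nonneg_left (mul_le_mul_of_nonneg_left hB1 (by positivity))
              (by positivity)) (hB0 _ _)
        _ = (1 + R) ^ k * ((n.choose i : ℝ) * B k i * B 0 (n - i)) := by ring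
    have hbω : Continuous fun ω : sphere (0 : E) 1 => b (z, ω) :=
      hbs.continuous.comp (continuous_const.prodMk continuous_subtype_val)
    calc ‖∫ ω, b (z, ω) • iteratedFDeriv ℝ n (fun r : ℝ × E × E => f (r - c₁ z ω) * f (r - c₂ z ω)) p
          ∂(sphereMeasure : Measure (sphere (0 : E) 1))‖
        ≤ ∫ ω, (K / w) * b (z, ω) ∂(sphereMeasure : Measure (sphere (0 : E) 1)) :=
          norm_integral_le_of_norm_le ((integrable_sphere_of_continuous hbω).const_mul _) (Eventually.of_forall hptw)
      _ = (K / w) * ∫ ω, b (z, ω) ∂(sphereMeasure : Measure (sphere (0 : E) 1)) := integral_const_mul _ _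
  -- integrate over the ball
  have hAc : Continuous fun z : E => ∫ ω, b (z, ω) ∂(sphereMeasure : Measure (sphere (0 : E) 1)) :=
    (contDiff_angularIntegral hbs).continuous
  have hAR : ∀ z : E, R ≤ ‖z‖ → ∫ ω, b (z, ω) ∂(sphereMeasure : Measure (sphere (0 : E) 1)) = 0 := fun z hz => by
    simp only [hbR z _ hz, integral_zero]
  rw [hGeq, hformula]
  calc w * ‖∫ z, iteratedFDeriv ℝ n (fun r : ℝ × E × E => I (id z, r)) p ∂((volume : Measure E).restrict (closedBall (0 : E) R))‖
      ≤ w * ∫ z, (K / w) * ∫ ω, b (z, ω) ∂(sphereMeasure : Measure (sphere (0 : E) 1))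
          ∂((volume : Measure E).restrict (closedBall (0 : E) R)) := by
        refine mul_le_mul_of_nonneg_left (norm_integral_le_of_norm_le ?_ (Eventually.of_forall hinner)) hw0.le
        exact ((continuous_const.mul hAc).continuousOn.integrableOn_compact (isCompact_closedBall _ _))
    _ = K * ∫ z in closedBall (0 : E) R, ∫ ω, b (z, ω) ∂(sphereMeasure : Measure (sphere (0 : E) 1)) := by
        rw [integral_const_mul, ← mul_assoc, mul_div_cancel₀ _ hw0.ne']
    _ = K * ∫ z, ∫ ω, b (z, ω) ∂(sphereMeasure : Measure (sphere (0 : E) 1)) := by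
        congr 1
        have h := integral_eq_setIntegral_closedBall hAR (fun _ => (1 : ℝ))
        simp only [mul_one] at h
        exact h.symm

end Gain

/-! ## The mass -/

section Mass

variable {f : ℝ × E × E → ℝ} {mf : ℝ × E → ℝ}

/-- **Derivative bounds for the mass**: `‖D^n m(t,x)‖ ≤ B ∫ (1+‖u‖)^{-k₀} du` whenever
`(1+‖(x,u)‖)^{k₀} ‖D^n f(t,x,u)‖ ≤ B` on the time set (`k₀ > dim E`), for `f` smooth with
Schwartz-type decay of all derivatives in `u` locally uniformly in time (this qualitative
hypothesis makes `D^n m = ∫ D^n f du` available through the time-localised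
`iteratedFDeriv_parametric_integral_of_dominated`). [folklore] -/
theorem mass_iteratedFDeriv_le (hf : ContDiff ℝ ((⊤ : ℕ∞) : WithTop ℕ∞) f) {r : ℝ} (hr : (Module.finrank ℝ E : ℝ) < r)
    (hdec : ∀ (n : ℕ) (T' : ℝ), ∃ C : ℝ, ∀ t : ℝ, |t| ≤ T' → ∀ x u : E,
      ‖iteratedFDeriv ℝ n f (t, x, u)‖ ≤ C * (1 + ‖u‖) ^ (-r))
    (hm : ∀ t x, mf (t, x) = ∫ u, f (t, x, u)) {S : Set ℝ} (n : ℕ) {k₀ : ℕ}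
    (hk₀ : (Module.finrank ℝ E : ℝ) < k₀) {B : ℝ}
    (hB : ∀ p : ℝ × E × E, p.1 ∈ S → (1 + ‖p.2‖) ^ k₀ * ‖iteratedFDeriv ℝ n f p‖ ≤ B)
    (q : ℝ × E) (hq : q.1 ∈ S) :
    ‖iteratedFDeriv ℝ n mf q‖ ≤ B * ∫ u : E, (1 + ‖u‖) ^ (-(k₀ : ℝ)) := by
  have hw : Integrable fun u : E => (1 + ‖u‖) ^ (-r) := integrable_one_add_norm hr
  have hw₀ : Integrable fun u : E => (1 + ‖u‖) ^ (-(k₀ : ℝ)) := integrable_one_add_norm hk₀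
  obtain ⟨t₀, x₀⟩ := q
  have hB0 : 0 ≤ B := le_trans (by positivity) (hB (t₀, x₀, (0 : E)) hq)
  -- localisation in time (as in `contDiff_mass`)
  let χ : ContDiffBump t₀ := ⟨1, 2, one_pos, one_lt_two⟩
  have hχs : ContDiff ℝ ((⊤ : ℕ∞) : WithTop ℕ∞) (χ : ℝ → ℝ) := χ.contDiff
  set e := LinearIsometryEquiv.prodAssoc ℝ ℝ E E with he
  set G : (ℝ × E) × E → ℝ := fun q => χ q.1.1 * f (q.1.1, q.1.2, q.2) with hGdef
  have hfe : (fun q : (ℝ × E) × E => f (q.1.1, q.1.2, q.2)) = f ∘ e := by funext q; rfl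
  have hL : ContDiff ℝ ((⊤ : ℕ∞) : WithTop ℕ∞) fun q : (ℝ × E) × E => χ q.1.1 := hχs.comp (contDiff_fst.comp contDiff_fst)
  have hfe' : ContDiff ℝ ((⊤ : ℕ∞) : WithTop ℕ∞) fun q : (ℝ × E) × E => f (q.1.1, q.1.2, q.2) := by
    rw [hfe]; exact hf.comp e.contDiff
  have hGs : ContDiff ℝ ((⊤ : ℕ∞) : WithTop ℕ∞) G := hL.mul hfe'
  have hχbound : ∀ i : ℕ, ∃ K : ℝ, ∀ q : (ℝ × E) × E, ‖iteratedFDeriv ℝ i (fun q : (ℝ × E) × E => χ q.1.1) q‖ ≤ K := by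
    intro i
    set Lf : (ℝ × E) × E →L[ℝ] ℝ := (ContinuousLinearMap.fst ℝ ℝ E).comp (ContinuousLinearMap.fst ℝ (ℝ × E) E) with hLf
    have hcomp : (fun q : (ℝ × E) × E => χ q.1.1) = (χ : ℝ → ℝ) ∘ Lf := by funext q; rfl
    obtain ⟨K, hK⟩ : ∃ K, ∀ s : ℝ, ‖iteratedFDeriv ℝ i (χ : ℝ → ℝ) s‖ ≤ K := by
      have hc : Continuous (iteratedFDeriv ℝ i (χ : ℝ → ℝ)) := hχs.continuous_iteratedFDeriv (by exact_mod_cast le_top)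
      have hcs : HasCompactSupport (iteratedFDeriv ℝ i (χ : ℝ → ℝ)) := χ.hasCompactSupport.iteratedFDeriv i
      obtain ⟨K, hK⟩ := hcs.exists_bound_of_continuous hc
      exact ⟨K, hK⟩
    refine ⟨max K 0 * ‖Lf‖ ^ i, fun q => ?_⟩
    rw [hcomp, Lf.iteratedFDeriv_comp_right hχs q (by exact_mod_cast le_top)]
    refine (ContinuousMultilinearMap.norm_compContinuousLinearMap_le _ _).trans ?_
    rw [Finset.prod_const, Finset.card_univ, Fintype.card_fin]
    exact mul_le_mul_of_nonneg_right ((hK _).trans (le_max_left _ _)) (by positivity)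
  have hGb : ∀ n : ℕ, ∃ bnd : E → ℝ, Integrable bnd ∧ ∀ p u, ‖iteratedFDeriv ℝ n G (p, u)‖ ≤ bnd u := by
    intro n
    choose K hK using hχbound
    choose C hC using fun j : ℕ => hdec j (|t₀| + 2)
    set A : ℝ := ∑ i ∈ Finset.range (n + 1), (n.choose i : ℝ) * (max (K i) 0) * (max (C (n - i)) 0) with hA
    refine ⟨fun u => A * (1 + ‖u‖) ^ (-r), hw.const_mul A, fun p u => ?_⟩
    by_cases hp : |p.1 - t₀| ≤ 2
    · have ht : |p.1| ≤ |t₀| + 2 := by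
        calc |p.1| = |(p.1 - t₀) + t₀| := by rw [sub_add_cancel]
          _ ≤ |p.1 - t₀| + |t₀| := abs_add_le _ _
          _ ≤ |t₀| + 2 := by linarith
      have hleib := norm_iteratedFDeriv_mul_le (n := n) hL hfe' (p, u) (by exact_mod_cast le_top)
      refine hleib.trans ?_
      show _ ≤ A * (1 + ‖u‖) ^ (-r)
      rw [hA, Finset.sum_mul]
      refine Finset.sum_le_sum fun i _ => ?_
      have h1 : ‖iteratedFDeriv ℝ i (fun q : (ℝ × E) × E => χ q.1.1) (p, u)‖ ≤ max (K i) 0 :=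
        (hK i (p, u)).trans (le_max_left _ _)
      have h2 : ‖iteratedFDeriv ℝ (n - i) (fun q : (ℝ × E) × E => f (q.1.1, q.1.2, q.2)) (p, u)‖ ≤
          max (C (n - i)) 0 * (1 + ‖u‖) ^ (-r) := by
        rw [hfe, e.norm_iteratedFDeriv_comp_right]
        exact (hC (n - i) p.1 ht p.2 u).trans (mul_le_mul_of_nonneg_right (le_max_left _ _) (by positivity))
      calc (n.choose i : ℝ) * ‖iteratedFDeriv ℝ i (fun q : (ℝ × E) × E => χ q.1.1) (p, u)‖ *
            ‖iteratedFDeriv ℝ (n - i) (fun q : (ℝ × E) × E => f (q.1.1, q.1.2, q.2)) (p, u)‖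
          ≤ (n.choose i : ℝ) * max (K i) 0 * (max (C (n - i)) 0 * (1 + ‖u‖) ^ (-r)) :=
            mul_le_mul (mul_le_mul_of_nonneg_left h1 (by positivity)) h2 (norm_nonneg _) (by positivity)
        _ = (n.choose i : ℝ) * max (K i) 0 * max (C (n - i)) 0 * (1 + ‖u‖) ^ (-r) := by ring
    · have hzero : iteratedFDeriv ℝ n G (p, u) = 0 := by
        refine image_eq_zero_of_notMem_tsupport fun h' => ?_
        have hts := tsupport_iteratedFDeriv_subset n h'
        have hsub : tsupport G ⊆ {q : (ℝ × E) × E | q.1.1 ∈ closedBall t₀ 2} := by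
          refine closure_minimal (fun q hq => ?_) ?_
          · have hχq : χ q.1.1 ≠ 0 := fun h0 => hq (by simp [hGdef, h0])
            have : q.1.1 ∈ Function.support (χ : ℝ → ℝ) := hχq
            rw [χ.support_eq] at this
            exact ball_subset_closedBall this
          · exact isClosed_closedBall.preimage (continuous_fst.comp continuous_fst)
        have := hsub hts
        simp only [mem_setOf_eq, mem_closedBall, Real.dist_eq] at this
        exact hp this
      rw [hzero, norm_zero]
      have hA0 : 0 ≤ A := Finset.sum_nonneg fun i _ => by positivity
      positivity
  -- `D^n m (t₀, x₀) = ∫ D^n (G(·, u)) (t₀, x₀) du`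
  have hnhds : {p : ℝ × E | p.1 ∈ ball t₀ 1} ∈ 𝓝 (t₀, x₀) :=
    (isOpen_ball.preimage continuous_fst).mem_nhds (by simp)
  have heq : (fun p : ℝ × E => ∫ u, G (p, u)) =ᶠ[𝓝 (t₀, x₀)] mf := by
    filter_upwards [hnhds] with p hp
    have hχ1 : χ p.1 = 1 := χ.one_of_mem_closedBall (ball_subset_closedBall hp)
    simp only [hGdef, hχ1, one_mul, hm]
  have hD : iteratedFDeriv ℝ n mf (t₀, x₀) = ∫ u, iteratedFDeriv ℝ n (fun p : ℝ × E => G (p, u)) (t₀, x₀) := by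
    rw [← (heq.iteratedFDeriv ℝ n).eq_of_nhds]
    exact iteratedFDeriv_parametric_integral_of_dominated hGs hGb n (t₀, x₀)
  -- the sections near `(t₀, x₀)` are sections of `f`
  have hsec : ∀ u : E, ‖iteratedFDeriv ℝ n (fun p : ℝ × E => G (p, u)) (t₀, x₀)‖ ≤ B * (1 + ‖u‖) ^ (-(k₀ : ℝ)) := by
    intro u
    have hloc : (fun p : ℝ × E => G (p, u)) =ᶠ[𝓝 (t₀, x₀)] fun p : ℝ × E => (f ∘ e) (p, u) := by
      filter_upwards [hnhds] with p hp
      have hχ1 : χ p.1 = 1 := χ.one_of_mem_closedBall (ball_subset_closedBall hp)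
      simp only [hGdef, hχ1, one_mul]
      rfl
    rw [(hloc.iteratedFDeriv ℝ n).eq_of_nhds]
    have h1 := norm_iteratedFDeriv_section_left_le (G := f ∘ e) (hf.comp e.contDiff) (t₀, x₀) u n
    refine h1.trans ?_
    rw [e.norm_iteratedFDeriv_comp_right]
    have hBu := hB (e ((t₀, x₀), u)) hq
    have he2 : (e ((t₀, x₀), u)).2 = (x₀, u) := rfl
    rw [he2] at hBu
    have hwpos : 0 < (1 + ‖(x₀, u)‖) ^ k₀ := by positivity
    have h2 : ‖iteratedFDeriv ℝ n f (e ((t₀, x₀), u))‖ ≤ B / (1 + ‖(x₀, u)‖) ^ k₀ := by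
      rw [le_div_iff₀ hwpos, mul_comm]; exact hBu
    refine h2.trans ?_
    rw [Real.rpow_neg (by positivity), Real.rpow_natCast, div_eq_mul_inv]
    refine mul_le_mul_of_nonneg_left ?_ hB0
    refine inv_anti₀ (by positivity) (pow_le_pow_left₀ (by positivity) ?_ _)
    simp only [Prod.norm_def, add_le_add_iff_left]
    exact le_max_right _ _
  rw [hD]
  calc ‖∫ u, iteratedFDeriv ℝ n (fun p : ℝ × E => G (p, u)) (t₀, x₀)‖
      ≤ ∫ u, B * (1 + ‖u‖) ^ (-(k₀ : ℝ)) := norm_integral_le_of_norm_le (hw₀.const_mul B) (Eventually.of_forall hsec)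
    _ = B * ∫ u : E, (1 + ‖u‖) ^ (-(k₀ : ℝ)) := integral_const_mul _ _

end Mass

/-! ## From weighted bounds to decay in the velocity variable -/

section Decay

variable {f : ℝ × E × E → ℝ}

omit [InnerProductSpace ℝ E] [FiniteDimensional ℝ E] [MeasurableSpace E] [BorelSpace E] in
/-- A weighted bound `(1 + ‖(x,u)‖)^{k₀} ‖D^n f‖ ≤ C` gives the decay `‖D^n f‖ ≤ C (1 + ‖u‖)^{-k₀}`
used by the mass lemmas. [folklore] -/
theorem decay_of_weighted_bound [NormedSpace ℝ E] {n k₀ : ℕ} {C : ℝ} {S : Set ℝ}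
    (h : ∀ p : ℝ × E × E, p.1 ∈ S → (1 + ‖p.2‖) ^ k₀ * ‖iteratedFDeriv ℝ n f p‖ ≤ C)
    (t : ℝ) (ht : t ∈ S) (x u : E) :
    ‖iteratedFDeriv ℝ n f (t, x, u)‖ ≤ max C 0 * (1 + ‖u‖) ^ (-(k₀ : ℝ)) := by
  have hp := h (t, x, u) ht
  have hwpos : 0 < (1 + ‖(x, u)‖) ^ k₀ := by positivity
  have h2 : ‖iteratedFDeriv ℝ n f (t, x, u)‖ ≤ max C 0 / (1 + ‖(x, u)‖) ^ k₀ := by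
    rw [le_div_iff₀ hwpos, mul_comm]; exact hp.trans (le_max_left _ _)
  refine h2.trans ?_
  rw [Real.rpow_neg (by positivity), Real.rpow_natCast, div_eq_mul_inv]
  refine mul_le_mul_of_nonneg_left ?_ (le_max_right _ _)
  refine inv_anti₀ (by positivity) (pow_le_pow_left₀ (by positivity) ?_ _)
  simp only [Prod.norm_def, add_le_add_iff_left]
  exact le_max_right _ _

end Decay

end Literature.MathematicalPhysics.KineticTheory
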